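import Literature.Geometry.Symplectic.FirstChernClassModTwoEqWuClassFourProofs
import Literature.Geometry.Symplectic.TopChernNumberFour
import HarnessLib

/-!
# `1 − b₁ + b⁺` is even for closed symplectic `4`-manifolds — what remains is Hirzebruch's formula

With Wu's formula `c₁(TM, J) ≡ v₂(M) (mod 2)` now a theorem
(`firstChernClass_modTwo_eq_wuClass_almostComplex_four_holds`,
`FirstChernClassModTwoEqWuClassFourProofs.lean`), the named fact
`even_one_add_bOne_add_bPlus_of_symplectic_four` (McDuff–Salamon 2017, §13.3 p. 527 with
Rem. 4.1.10) depends on exactly ONE remaining input: (H) `⟨c₁², [N]⟩ = 2χ + 3σ` for closed almost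
complex `4`-manifolds (the named fact `hirzebruch_firstChernClass_sq_eq_almostComplex_four`), itself
reduced to the signature theorem `⟨p₁, [N]⟩ = 3σ` in dimension `4`
(`hirzebruch_firstChernClass_sq_eq_almostComplex_four_of_signatureTheorem`, `TopChernNumberFour.lean`).
This leaf file records the one-hypothesis forms:

* `even_one_add_bOne_add_bPlus_almostComplex_four_of_hirzebruch` — (H) ⇒ `1 + b₁ + b⁺` even for every
  closed connected almost complex `4`-manifold with its complex orientation;
* `even_one_add_bOne_add_bPlus_of_symplectic_four_of_hirzebruch` — (H) ⇒ the named fact;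
* `even_one_add_bOne_add_bPlus_of_symplectic_four_of_signatureTheorem` — the signature theorem in
  dimension `4` ⇒ the named fact.

No named facts are introduced (D-0026).

## References

* D. McDuff, D. Salamon, *Introduction to Symplectic Topology*, 3rd ed., OUP (2017), §13.3 p. 527,
  Rem. 13.3.5, Rem. 4.1.10 (pp. 161–162). [McDuffSalamon2017]
* J. Milnor, J. Stasheff, *Characteristic Classes* (1974), Thm. 11.14, Problem 14-B, Cor. 11.12, §19. [MilnorStasheff1974]
* F. Hirzebruch, *Topological Methods in Algebraic Geometry*, 3rd ed. (1966), Thm. 8.2.2. [Hirzebruch1966]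
-/

noncomputable section

open scoped Manifold ContDiff
open Literature.AlgebraicTopology.SingularHomology Literature.AlgebraicTopology.CharacteristicClasses
open Literature.Topology.FourManifolds

namespace Literature.Geometry.Symplectic

/-- **(H) ⇒ `1 + b₁ + b⁺` is even for closed connected almost complex `4`-manifolds** (with the
complex orientation), Wu's formula being proved. [cite: McDuffSalamon2017, Rem. 4.1.10 (pp. 161–162)] -/
theorem even_one_add_bOne_add_bPlus_almostComplex_four_of_hirzebruch
    (hH : hirzebruch_firstChernClass_sq_eq_almostComplex_four)
    {N : Type} [TopologicalSpace N] [T2Space N] [SecondCountableTopology N] [CompactSpace N]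
    [ConnectedSpace N] [ChartedSpace (EuclideanSpace ℝ (Fin 4)) N] [IsManifold (𝓡 4) ∞ N]
    (J : AlmostComplexStructure (𝓡 4) ∞ N) (μ : HomologicalOrientation ℤ N 4)
    (hμ : μ.IsComplexOrientationOf J) :
    Even (1 + Module.finrank ℤ (singularHomology ℤ ℤ N 1) +
      sigPos (intersectionForm two_add_two_eq_four μ).toQuadraticMap) :=
  even_one_add_bOne_add_bPlus_almostComplex_four_of_hirzebruch_of_wuClass hH
    firstChernClass_modTwo_eq_wuClass_almostComplex_four_holds J μ hμ

/-- **(H) ⇒ `even_one_add_bOne_add_bPlus_of_symplectic_four`**: the only remaining input of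
McDuff–Salamon's Rem. 4.1.10 argument is Hirzebruch's formula `⟨c₁², [N]⟩ = 2χ + 3σ`.
[cite: McDuffSalamon2017, §13.3 p. 527 and Rem. 4.1.10] -/
theorem even_one_add_bOne_add_bPlus_of_symplectic_four_of_hirzebruch
    (hH : hirzebruch_firstChernClass_sq_eq_almostComplex_four) :
    even_one_add_bOne_add_bPlus_of_symplectic_four :=
  even_one_add_bOne_add_bPlus_of_symplectic_four_of_hirzebruch_of_wuClass hH
    firstChernClass_modTwo_eq_wuClass_almostComplex_four_holds

/-- **The signature theorem in dimension `4` ⇒ `even_one_add_bOne_add_bPlus_of_symplectic_four`**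
(`⟨c₂, [N]⟩ = χ`, `p₁ = c₁² − 2c₂` and Wu's formula are proved).
[cite: McDuffSalamon2017, §13.3 p. 527 and Rem. 4.1.10] [cite: Hirzebruch1966, Thm. 8.2.2] -/
theorem even_one_add_bOne_add_bPlus_of_symplectic_four_of_signatureTheorem
    (hsig : ∀ (N : Type) [TopologicalSpace N] [T2Space N] [SecondCountableTopology N]
      [CompactSpace N] [ConnectedSpace N] [ChartedSpace (EuclideanSpace ℝ (Fin 4)) N]
      [IsManifold (𝓡 4) ∞ N] (μ : HomologicalOrientation ℤ N 4),
      kroneckerPairing ℤ ℤ N 4 (degCast ℤ (by norm_num : 4 * 1 = 4) (tangentPontryaginClass (𝓡 4) N 1))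
        μ.fundamentalClass = 3 * μ.signature) :
    even_one_add_bOne_add_bPlus_of_symplectic_four :=
  even_one_add_bOne_add_bPlus_of_symplectic_four_of_signatureTheorem_of_wuClass hsig
    firstChernClass_modTwo_eq_wuClass_almostComplex_four_holds

end Literature.Geometry.Symplectic
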